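import Summits.Ventures.CertifiedManyBodySolver.Observables.EtaPairingExclusionAboveThreeHalvesFilling
import Literature.MathematicalPhysics.QuantumLattice.HubbardNNNHoppingTorusLimitCorrelator
import HarnessLib

/-!
# η-PAIRING ODLRO EXCLUSION REGION — TORUS-LIMIT (ROW-CLASS) FORMS: every torus limit of unit sector ground
# states is a translation-invariant ground state of its filling, so the region theorems apply to the cell's row class

HONEST FRAMING: exclusions in Yang's staggered `s`-wave (η) pair channel, where nobody expects order; CTL/dictionary class; not
a superconductivity verdict; no phase sentence. Crew hubbard-obs (D-0042), seat hubbard-obs-p1 (`prover-hubbard-obs-p1-g15-0`);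
part 7 of the g15 η files. ZERO compute; no definition; no `sorry`; no claim node.

* §1 `rowClass_of_groundStateClass` — THE BRIDGE (a one-liner on the tree's `IsTorusLimitOf.invariances_of_sectorGroundState_TT'`
  and `IsTorusLimitOf.meanEnergy_hubbardTTPrime_eq_energyDensityTT'`): any property holding for every translation-invariant
  state of density `n` attaining `e(1,0,U,n)` holds for every torus limit `ω` of unit `(rectN n L, S^z = 0)`-sector ground states of
  `hubbardTorusTT' L 1 0 U` along `Ls → ∞` (`U ≥ 0`, `0 ≤ n < 2`) — the registry's row class.
* §2 the torus-limit forms of the four headline region theorems of parts 1 and 3: below quarter filling (every `U > 0`),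
  at quarter filling (every `U ≥ 0`), above three-halves filling (every `U > 0`), at three-halves filling (every `U ≥ 0`);
  and of the generic window form `etaPairing_exclusion_of_floor` (any floor with positive one-body margin). The windows,
  cells and electron-doped twins of parts 2, 4, 5, 6 transfer by the same one-liner.

References: D. Ruelle, *Statistical Mechanics* (1969) §3.3–3.4 [Ruelle1969]; O. Bratteli, D. W. Robinson, OAQSM 2 (1997) §6.2.4,
Prop. 5.3.19 [BratteliRobinsonII1997]; C. N. Yang, PRL 63 (1989) 2144 [Yang1989].
-/

noncomputable section

namespace Summit.Ventures.CertifiedManyBodySolver.Observables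

open Matrix Finset Filter Literature.MathematicalPhysics.QuantumLattice Literature.Probability.LatticeModels
open Literature.MathematicalPhysics.QuantumLattice.HubbardWave0 ThermodynamicLimit
open scoped ComplexOrder Topology

/-! ### §1 The bridge: torus limits of sector ground states are translation-invariant ground states of their filling -/

/-- **ROW CLASS ⊆ GROUND-STATE CLASS.** For `U ≥ 0`, `0 ≤ n < 2`: if a property `P` holds for every translation-invariant
state `ω` of density `n` with `e(ω) = e(1,0,U,n)`, then it holds for every torus limit of unit `(rectN n L, S^z = 0)`-sector
ground states of `hubbardTorusTT' L 1 0 U` along `Ls → ∞`. [cite: Ruelle1969, §3.4] [cite: BratteliRobinsonII1997, §6.2.4] -/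
theorem rowClass_of_groundStateClass {U n : ℝ} (hU : 0 ≤ U) (hn0 : 0 ≤ n) (hn2 : n < 2)
    {P : InfVolFermionState 2 → Prop}
    (h : ∀ {ω : InfVolFermionState 2}, ω.IsTranslationInvariant → ω.density = n →
      ω.meanEnergy (hubbardTTPrimeFermionInteraction 1 0 U) 1 = energyDensityTT' 1 0 U n → P ω)
    {Ls : ℕ → ℕ} (hLs : Tendsto Ls atTop atTop) {ψ : ∀ L, Fock (Orb (FermionTorus 2 L))}
    (hψ : ∀ L, IsGroundStateInSector (hubbardTorusTT' L 1 0 U) (rectN n L) 0 (ψ L))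
    (hψ1 : ∀ j, star (ψ (Ls j)) ⬝ᵥ ψ (Ls j) = 1)
    {ω : InfVolFermionState 2} (hωlim : ω.IsTorusLimitOf ψ Ls) : P ω := by
  obtain ⟨hTI, -, hρ⟩ := hωlim.invariances_of_sectorGroundState_TT' 1 0 U hn0 hLs hψ hψ1
  exact h hTI hρ (hωlim.meanEnergy_hubbardTTPrime_eq_energyDensityTT' 1 0 hU hn0 hn2 hLs (fun j => hψ (Ls j)) hψ1)

/-! ### §2 Torus-limit forms of the region theorems -/

/-- **BELOW QUARTER FILLING, row class**: for `U > 0`, `0 < n < 1/2`, every torus limit `ω` of unit `(rectN n L, S^z = 0)`-sector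
ground states of `hubbardTorusTT' L 1 0 U` has `M⁻⁴ Re ω(η†_{Λ_M} η_{Λ_M}) → 0` and
`Re ω(η†_Λ η_Λ) ≤ 64(|Λ'| − |Λ|)²/(U(1 − 2n)/(2(1 − n)))²`. [cite: Yang1989, eqs. (6)–(8)] [cite: BratteliRobinsonII1997, Prop. 5.3.19]
[cite: Ruelle1969, §3.4] -/
theorem etaPairing_exclusion_of_lt_quarterFilling_of_isTorusLimitOf {U n : ℝ} (hU : 0 < U) (hn0 : 0 < n)
    (hn : n < 1 / 2) {Ls : ℕ → ℕ} (hLs : Tendsto Ls atTop atTop) {ψ : ∀ L, Fock (Orb (FermionTorus 2 L))}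
    (hψ : ∀ L, IsGroundStateInSector (hubbardTorusTT' L 1 0 U) (rectN n L) 0 (ψ L))
    (hψ1 : ∀ j, star (ψ (Ls j)) ⬝ᵥ ψ (Ls j) = 1)
    {ω : InfVolFermionState 2} (hωlim : ω.IsTorusLimitOf ψ Ls) :
    Tendsto (fun M : ℕ =>
        (ω.expect (halfOpenBox 2 M) (etaRaise (fun w : PolySite (halfOpenBox 2 M) => siteStagger (ofLex w.1)) *
          etaLower (fun w : PolySite (halfOpenBox 2 M) => siteStagger (ofLex w.1)))).re / (M : ℝ) ^ 4)
        atTop (𝓝 0) ∧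
      ∀ {Λ Λ' : Finset (Site 2)}, Λ ⊆ Λ' → thicken Λ 1 ⊆ Λ' →
        (ω.expect Λ (etaRaise (fun w : PolySite Λ => siteStagger (ofLex w.1)) *
            etaLower (fun w : PolySite Λ => siteStagger (ofLex w.1)))).re ≤
          64 * ((#Λ' : ℝ) - #Λ) ^ 2 / (U * (1 - 2 * n) / (2 * (1 - n))) ^ 2 :=
  rowClass_of_groundStateClass hU.le hn0.le (by linarith)
    (fun hTI hρ hme => etaPairing_exclusion_of_lt_quarterFilling hU hn0 hn hTI hρ hme) hLs hψ hψ1 hωlim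

/-- **QUARTER FILLING, row class**: for every `U ≥ 0`, every torus limit of unit `(rectN (1/2) L, S^z = 0)`-sector ground states
has `M⁻⁴ Re ω(η†η) → 0` and `Re ω(η†_Λ η_Λ) ≤ 64(|Λ'| − |Λ|)²/1.2251963²`. [cite: Yang1989, eqs. (6)–(8)]
[cite: BratteliRobinsonII1997, Prop. 5.3.19] [cite: Ruelle1969, §3.4] -/
theorem etaPairing_exclusion_quarterFilling_of_isTorusLimitOf {U : ℝ} (hU : 0 ≤ U)
    {Ls : ℕ → ℕ} (hLs : Tendsto Ls atTop atTop) {ψ : ∀ L, Fock (Orb (FermionTorus 2 L))}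
    (hψ : ∀ L, IsGroundStateInSector (hubbardTorusTT' L 1 0 U) (rectN (1 / 2) L) 0 (ψ L))
    (hψ1 : ∀ j, star (ψ (Ls j)) ⬝ᵥ ψ (Ls j) = 1)
    {ω : InfVolFermionState 2} (hωlim : ω.IsTorusLimitOf ψ Ls) :
    Tendsto (fun M : ℕ =>
        (ω.expect (halfOpenBox 2 M) (etaRaise (fun w : PolySite (halfOpenBox 2 M) => siteStagger (ofLex w.1)) *
          etaLower (fun w : PolySite (halfOpenBox 2 M) => siteStagger (ofLex w.1)))).re / (M : ℝ) ^ 4)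
        atTop (𝓝 0) ∧
      ∀ {Λ Λ' : Finset (Site 2)}, Λ ⊆ Λ' → thicken Λ 1 ⊆ Λ' →
        (ω.expect Λ (etaRaise (fun w : PolySite Λ => siteStagger (ofLex w.1)) *
            etaLower (fun w : PolySite Λ => siteStagger (ofLex w.1)))).re ≤
          64 * ((#Λ' : ℝ) - #Λ) ^ 2 / (1.2251963 : ℝ) ^ 2 :=
  rowClass_of_groundStateClass hU (by norm_num) (by norm_num)
    (fun hTI hρ hme => etaPairing_exclusion_quarterFilling hU hTI hρ hme) hLs hψ hψ1 hωlim

/-- **ABOVE THREE-HALVES FILLING, row class**: for `U > 0`, `3/2 < n < 2`, every torus limit of unit `(rectN n L, S^z = 0)`-sector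
ground states has `M⁻⁴ Re ω(η†η) → 0` and `Re ω(η†_Λ η_Λ) ≤ 64(|Λ'| − |Λ|)²/(U(2n − 3)/(2(n − 1)))² + (n − 1)|Λ|`.
[cite: Yang1989, eqs. (6)–(8)] [cite: LiebPRL1989, proof of Theorem 2] [cite: Ruelle1969, §3.4] -/
theorem etaPairing_exclusion_of_gt_threeHalvesFilling_of_isTorusLimitOf {U n : ℝ} (hU : 0 < U) (hn : 3 / 2 < n)
    (hn2 : n < 2) {Ls : ℕ → ℕ} (hLs : Tendsto Ls atTop atTop) {ψ : ∀ L, Fock (Orb (FermionTorus 2 L))}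
    (hψ : ∀ L, IsGroundStateInSector (hubbardTorusTT' L 1 0 U) (rectN n L) 0 (ψ L))
    (hψ1 : ∀ j, star (ψ (Ls j)) ⬝ᵥ ψ (Ls j) = 1)
    {ω : InfVolFermionState 2} (hωlim : ω.IsTorusLimitOf ψ Ls) :
    Tendsto (fun M : ℕ =>
        (ω.expect (halfOpenBox 2 M) (etaRaise (fun w : PolySite (halfOpenBox 2 M) => siteStagger (ofLex w.1)) *
          etaLower (fun w : PolySite (halfOpenBox 2 M) => siteStagger (ofLex w.1)))).re / (M : ℝ) ^ 4)
        atTop (𝓝 0) ∧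
      ∀ {Λ Λ' : Finset (Site 2)}, Λ ⊆ Λ' → thicken Λ 1 ⊆ Λ' →
        (ω.expect Λ (etaRaise (fun w : PolySite Λ => siteStagger (ofLex w.1)) *
            etaLower (fun w : PolySite Λ => siteStagger (ofLex w.1)))).re ≤
          64 * ((#Λ' : ℝ) - #Λ) ^ 2 / (U * (2 * n - 3) / (2 * (n - 1))) ^ 2 + (n - 1) * #Λ :=
  rowClass_of_groundStateClass hU.le (by linarith) hn2
    (fun hTI hρ hme => etaPairing_exclusion_of_gt_threeHalvesFilling hU hn hn2 hTI hρ hme) hLs hψ hψ1 hωlim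

/-- **THREE-HALVES FILLING, row class**: for every `U ≥ 0`, every torus limit of unit `(rectN (3/2) L, S^z = 0)`-sector ground
states has `M⁻⁴ Re ω(η†η) → 0` and `Re ω(η†_Λ η_Λ) ≤ 64(|Λ'| − |Λ|)²/1.2251963² + |Λ|/2`. [cite: Yang1989, eqs. (6)–(8)]
[cite: LiebPRL1989, proof of Theorem 2] [cite: Ruelle1969, §3.4] -/
theorem etaPairing_exclusion_threeHalvesFilling_of_isTorusLimitOf {U : ℝ} (hU : 0 ≤ U)
    {Ls : ℕ → ℕ} (hLs : Tendsto Ls atTop atTop) {ψ : ∀ L, Fock (Orb (FermionTorus 2 L))}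
    (hψ : ∀ L, IsGroundStateInSector (hubbardTorusTT' L 1 0 U) (rectN (3 / 2) L) 0 (ψ L))
    (hψ1 : ∀ j, star (ψ (Ls j)) ⬝ᵥ ψ (Ls j) = 1)
    {ω : InfVolFermionState 2} (hωlim : ω.IsTorusLimitOf ψ Ls) :
    Tendsto (fun M : ℕ =>
        (ω.expect (halfOpenBox 2 M) (etaRaise (fun w : PolySite (halfOpenBox 2 M) => siteStagger (ofLex w.1)) *
          etaLower (fun w : PolySite (halfOpenBox 2 M) => siteStagger (ofLex w.1)))).re / (M : ℝ) ^ 4)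
        atTop (𝓝 0) ∧
      ∀ {Λ Λ' : Finset (Site 2)}, Λ ⊆ Λ' → thicken Λ 1 ⊆ Λ' →
        (ω.expect Λ (etaRaise (fun w : PolySite Λ => siteStagger (ofLex w.1)) *
            etaLower (fun w : PolySite Λ => siteStagger (ofLex w.1)))).re ≤
          64 * ((#Λ' : ℝ) - #Λ) ^ 2 / (1.2251963 : ℝ) ^ 2 + 1 / 2 * #Λ :=
  rowClass_of_groundStateClass hU (by norm_num) (by norm_num)
    (fun hTI hρ hme => etaPairing_exclusion_threeHalvesFilling hU hTI hρ hme) hLs hψ hψ1 hωlim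

/-- **GENERIC WINDOW FORM, row class**: `U ≥ 0`, `0 < n < 1`, a floor `ℓ ≤ e(1,0,U,n)` with positive one-body margin
`U(1 − 2n) + 4(ℓ + 1.6211389) > 0` ⇒ every torus limit of unit `(rectN n L, S^z = 0)`-sector ground states has
`M⁻⁴ Re ω(η†η) → 0` and `Re ω(η†_Λ η_Λ) ≤ 64(|Λ'| − |Λ|)²/m²`, `m = (U(1 − 2n) + 4(ℓ + 1.6211389))/(2(1 − n))`.
[cite: Yang1989, eqs. (6)–(8)] [cite: BratteliRobinsonII1997, Prop. 5.3.19] [cite: Ruelle1969, §3.4] -/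
theorem etaPairing_exclusion_of_floor_of_isTorusLimitOf {U n ℓ : ℝ} (hU : 0 ≤ U) (hn0 : 0 < n) (hn1 : n < 1)
    (hℓ : ℓ ≤ energyDensityTT' 1 0 U n) (hm : 0 < U * (1 - 2 * n) + 4 * (ℓ + 1.6211389))
    {Ls : ℕ → ℕ} (hLs : Tendsto Ls atTop atTop) {ψ : ∀ L, Fock (Orb (FermionTorus 2 L))}
    (hψ : ∀ L, IsGroundStateInSector (hubbardTorusTT' L 1 0 U) (rectN n L) 0 (ψ L))
    (hψ1 : ∀ j, star (ψ (Ls j)) ⬝ᵥ ψ (Ls j) = 1)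
    {ω : InfVolFermionState 2} (hωlim : ω.IsTorusLimitOf ψ Ls) :
    Tendsto (fun M : ℕ =>
        (ω.expect (halfOpenBox 2 M) (etaRaise (fun w : PolySite (halfOpenBox 2 M) => siteStagger (ofLex w.1)) *
          etaLower (fun w : PolySite (halfOpenBox 2 M) => siteStagger (ofLex w.1)))).re / (M : ℝ) ^ 4)
        atTop (𝓝 0) ∧
      ∀ {Λ Λ' : Finset (Site 2)}, Λ ⊆ Λ' → thicken Λ 1 ⊆ Λ' →
        (ω.expect Λ (etaRaise (fun w : PolySite Λ => siteStagger (ofLex w.1)) *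
            etaLower (fun w : PolySite Λ => siteStagger (ofLex w.1)))).re ≤
          64 * ((#Λ' : ℝ) - #Λ) ^ 2 / ((U * (1 - 2 * n) + 4 * (ℓ + 1.6211389)) / (2 * (1 - n))) ^ 2 :=
  rowClass_of_groundStateClass hU hn0.le (by linarith)
    (fun hTI hρ hme => etaPairing_exclusion_of_floor hU hn0 hn1 hℓ hm hTI hρ hme) hLs hψ hψ1 hωlim

end Summit.Ventures.CertifiedManyBodySolver.Observables

end
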